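import Summits.CriticalPhenomena.PercolationContinuityZ3.Theorems.Transplant.SkeletonDropNode
import HarnessLib

/-!
# Interface Φ0 for the GENERIC design-(D) re-typing: `PlanarSkeletonConc` (= `PlanarSkeleton` + the three interface additions of
# SHEAR-SCOPE §3.3: (ι) outward steps, (κ) connected induced cylinders, (μ) a degree bound), the coordinate-free windows `Win P R`
# (fibre depth `fd := d_G(w₀, ·)`, §3.1) and the general DROP NODE in (D)-form, **`SamePDropOfSkeletonConc`** (`@[conjecture]`, never asserted)

builds on p205010 (kernel theorem, internal audit signed; external expert review pending).
Status sentence (coordinator 2026-08-20T04:30Z): "θ(p_c) = 0 on ℤ^d, all d ≥ 2 — kernel-verified (Lean 4/Mathlib, standard axioms); internal adversarial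
audit SIGNED 2026-08-20 04:29Z; external expert review pending."
Lane `prim-bschramm-*`, seat `prim-bschramm-stmt` (gen 6; lead g3 17:41:00Z (2), design of record SHEAR-SCOPE §p3 / VERDICTS V83); helper file
(`--supports stmt-CriticalPhenomena-4575`).  DEFINITIONS ONLY; the node is the target of TOMORROW's generic re-typing of the landed `X □ ℤ²`
instance layer (`thetaDropBoxProdZ2_holds`, p228654) over windows `Win P R = {g : φ g ∈ P, d_G(w₀, g) ≤ R}` instead of `B_X(w₀, R) × P`.

* `PlanarSkeletonConc G` — `PlanarSkeleton G` + `Δ`/`degree_le` (μ) + `step` (ι: `∀ v i σ, ∃ v' ~ v, φ v' = φ v + σ e_i`) + `cyl_connected`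
  (κ: the induced graph on every cylinder `φ⁻¹(φ t + Λ_ℓ)`, `ℓ ≥ 1`, at a base vertex is connected).  NOT added (lead's ruling (1)): `lip1` —
  the one ℓ¹-tight planar separation is cured by re-dimensioning the between-boxes (`5r ↦ 5r − 1`), not by an interface field.  (ν) "root ∈
  types" is the quantifier `∀ t ∈ Φ.types` of the node.  `Countable V` stays a binder (it follows from connected + locally finite).
* `PlanarSkeletonConc.Win w₀ P R` (finite window over `P : Finset (Site 2)`), `mem_Win`, `Win_mono`, `Win_subset_union`, `disjoint_Win`;
  `PlanarSkeletonConc.stair w₀ P ρ` (staircase window, a `Finset`), `mem_stair`, `stair_subset_Win`; `PlanarSkeletonConc.cylBall t ℓ R` (ball in the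
  INDUCED cylinder graph, (C1)), `cylBall_subset_prism`; reviewed by p3-g4 (17:46Z, R1–R3) and the lead (17:46Z);
* **`SamePDropOfSkeletonConc`** — for every connected, locally finite, countable `G` with a `PlanarSkeletonConc`, every base vertex `t` and
  density `p`: a.s. uniqueness at `p`, `CylSubcritical p` and `θ_t(p) > 0` give `θ_t(q) > 0` at some `q < p`;
  `samePDropOfSkeletonConc_of_samePDropOfSkeleton` (the general node over bare skeletons implies it), `continuity_of_skeletonConc_drop(_amenable)`.
[cite: KozmaNitzan2024, §1 p. 2 (approach 1); §4 pp. 15–31] [cite: BenjaminiSchramm1996, Conj. 4] [cite: LyonsPeres2016, Thm. 7.6]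
-/

noncomputable section

namespace Summit.CriticalPhenomena.PercolationContinuityZ3.Theorems.Transplant

open MeasureTheory Literature.Probability.Percolation Literature.Probability.LatticeModels
open Literature.Probability.Percolation.GM
open Literature.Barriers.CriticalPhenomena (IsQuasiTransitive IsGraphAmenable graphBall graphBall_finite graphBall_mono
  BurtonKeane1989_atMostOneInfiniteCluster_holds countable_of_connected_of_locallyFinite)
open scoped Classical

/-- **Planar skeleton with the design-(D) interface** (SHEAR-SCOPE §3.3): a `PlanarSkeleton` together with (μ) a degree bound, (ι) outward
steps in every skeleton direction at every vertex, (κ) connectedness of the graph induced on every cylinder at a base vertex.  Instances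
intended (each must supply `degree_le` / `step` / `cyl_connected`): `H₃(ℤ)` (`heisSkeleton`), `H₃(ℤ) × ℤ^k`, `H_{2k+1}` (`hkSkeleton`),
`N_{m,2}` (`fnSkeleton`, rank 2 part), fcc/bcc (`CubicLatticesPlanarSkeleton` / `BccPlanarSkeleton`), and every `X □ ℤ²` (`boxProdZ2Skeleton`).
[cite: KozmaNitzan2024, §4 p. 15 (the role of the symmetries of ℤ^d)] -/
structure PlanarSkeletonConc {V : Type} (G : SimpleGraph V) [G.LocallyFinite] extends PlanarSkeleton G where
  /-- (μ) a degree bound -/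
  Δ : ℕ
  /-- every vertex has degree `≤ Δ` -/
  degree_le : ∀ v : V, G.degree v ≤ Δ
  /-- (ι) OUTWARD STEPS: a neighbour moving the skeleton coordinate by `σ e_i`, at every vertex, for every axis and sign.  NO fibre
  (`φ`-preserving) steps are assumed — in `H₃ = Cay(H₃; a, b)` every edge moves `φ`. -/
  step : ∀ (v : V) (i : Fin 2) (σ : ℤˣ), ∃ v' : V, G.Adj v v' ∧ φ v' = φ v + Pi.single i (σ : ℤ)
  /-- (κ) the graph induced on each cylinder `φ⁻¹(φ t + Λ_ℓ)`, `ℓ ≥ 1`, at a BASE vertex is connected (enough: at a non-base centre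
  `c = α t` the frame `α` restricts to `G.induce (cyl t ℓ) ≃g G.induce (cyl c ℓ)` since `φ ∘ α = φ + (φ c - φ t)`) -/
  cyl_connected : ∀ t ∈ types, ∀ ℓ : ℕ, 1 ≤ ℓ → (G.induce {w | φ w - φ t ∈ box 2 ℓ}).Connected

namespace PlanarSkeletonConc

variable {V : Type} {G : SimpleGraph V} [G.LocallyFinite] (Φ : PlanarSkeletonConc G)

/-- The cylinders of the underlying skeleton are the sets of field (κ). [folklore] -/
theorem cyl_eq (t : V) (ℓ : ℕ) : Φ.toPlanarSkeleton.cyl t ℓ = {w | Φ.φ w - Φ.φ t ∈ box 2 ℓ} := rfl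

/-- (κ) restated for `PlanarSkeleton.cyl`. [folklore] -/
theorem induce_cyl_connected {t : V} (ht : t ∈ Φ.types) {ℓ : ℕ} (hℓ : 1 ≤ ℓ) : (G.induce (Φ.toPlanarSkeleton.cyl t ℓ)).Connected :=
  Φ.cyl_connected t ht ℓ hℓ

/-- **The coordinate-free WINDOW** over the planar set `P` at fibre depth `R` from the root `w₀`: `{g : d_G(w₀, g) ≤ R, φ g ∈ P}` (SHEAR-SCOPE
§3.1: replaces the product window `B_X(w₀, R) × P`). [this work] -/
def Win (w₀ : V) (P : Finset (Site 2)) (R : ℕ) : Finset V := (graphBall_finite G w₀ R).toFinset.filter fun g => Φ.φ g ∈ P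

/-- Membership in a window. [folklore] -/
theorem mem_Win {w₀ : V} {P : Finset (Site 2)} {R : ℕ} {g : V} : g ∈ Φ.Win w₀ P R ↔ g ∈ graphBall G w₀ R ∧ Φ.φ g ∈ P := by
  simp [Win, Set.Finite.mem_toFinset]

/-- Windows grow with the planar set and the depth. [folklore] -/
theorem Win_mono {w₀ : V} {P P' : Finset (Site 2)} (hP : P ⊆ P') {R R' : ℕ} (hR : R ≤ R') : Φ.Win w₀ P R ⊆ Φ.Win w₀ P' R' := by
  intro g hg
  rw [mem_Win] at hg ⊢
  exact ⟨graphBall_mono G w₀ hR hg.1, hP hg.2⟩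

/-- A window over `P ⊆ P₁ ∪ P₂` lies in the union of the windows (twin of `Finset.product_subset_union` for `sepGeom`). [folklore] -/
theorem Win_subset_union {w₀ : V} {P P₁ P₂ : Finset (Site 2)} (hP : P ⊆ P₁ ∪ P₂) {R R₁ R₂ : ℕ} (h₁ : R ≤ R₁) (h₂ : R ≤ R₂) :
    Φ.Win w₀ P R ⊆ Φ.Win w₀ P₁ R₁ ∪ Φ.Win w₀ P₂ R₂ := by
  intro g hg
  rw [mem_Win] at hg
  rw [Finset.mem_union, mem_Win, mem_Win]
  rcases Finset.mem_union.1 (hP hg.2) with h | h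
  · exact Or.inl ⟨graphBall_mono G w₀ h₁ hg.1, h⟩
  · exact Or.inr ⟨graphBall_mono G w₀ h₂ hg.1, h⟩

/-- Windows over disjoint planar sets are disjoint (twin of `disjoint_product_of_right`). [folklore] -/
theorem disjoint_Win {w₀ : V} {P P' : Finset (Site 2)} (h : Disjoint P P') (R R' : ℕ) : Disjoint (Φ.Win w₀ P R) (Φ.Win w₀ P' R') := by
  rw [Finset.disjoint_left]
  intro g hg hg'
  rw [mem_Win] at hg hg'
  exact Finset.disjoint_left.1 h hg.2 hg'.2

/-- **The STAIRCASE window**: fibre depth bounded by a planar profile `ρ`: `{g : φ g ∈ P, d_G(w₀, g) ≤ ρ (φ g)}` (replaces `stair X w₀ ρ P`).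
[this work] -/
def stair (w₀ : V) (P : Finset (Site 2)) (ρ : Site 2 → ℕ) : Finset V :=
  P.biUnion fun x => (graphBall_finite G w₀ (ρ x)).toFinset.filter fun g => Φ.φ g = x

/-- Membership in a staircase window. [folklore] -/
theorem mem_stair {w₀ : V} {P : Finset (Site 2)} {ρ : Site 2 → ℕ} {g : V} :
    g ∈ Φ.stair w₀ P ρ ↔ Φ.φ g ∈ P ∧ g ∈ graphBall G w₀ (ρ (Φ.φ g)) := by
  simp only [stair, Finset.mem_biUnion, Finset.mem_filter, Set.Finite.mem_toFinset]
  constructor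
  · rintro ⟨x, hx, hg, rfl⟩; exact ⟨hx, hg⟩
  · rintro ⟨hP, hg⟩; exact ⟨_, hP, hg, rfl⟩

/-- A staircase window under a uniform profile bound lies in the flat window. [folklore] -/
theorem stair_subset_Win {w₀ : V} {P : Finset (Site 2)} {ρ : Site 2 → ℕ} {R : ℕ} (hρ : ∀ x ∈ P, ρ x ≤ R) :
    Φ.stair w₀ P ρ ⊆ Φ.Win w₀ P R := by
  intro g hg
  rw [mem_stair] at hg
  rw [mem_Win]
  exact ⟨graphBall_mono G w₀ (hρ _ hg.1) hg.2, hg.1⟩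

/-- **The ball of radius `R` about `t` INSIDE the induced cylinder of half-width `ℓ`** (the generic fat prism / wired source: connected by
construction; SHEAR-SCOPE §3.0 item 4 (C1)). [this work] -/
def cylBall (t : V) (ℓ R : ℕ) : Set V :=
  Subtype.val '' graphBall (G.induce (Φ.toPlanarSkeleton.cyl t ℓ)) ⟨t, Φ.toPlanarSkeleton.mem_cyl_self t ℓ⟩ R

omit [G.LocallyFinite] in
/-- A walk of an induced graph gives a walk of `G` of the same length. [folklore] -/
theorem exists_walk_of_induce {S : Set V} : ∀ {x y : S} (w : (G.induce S).Walk x y), ∃ w' : G.Walk (x : V) (y : V), w'.length = w.length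
  | _, _, .nil => ⟨.nil, rfl⟩
  | _, _, .cons h w => by
    obtain ⟨w', hw'⟩ := exists_walk_of_induce w
    exact ⟨.cons (SimpleGraph.induce_adj.1 h) w', by simp [hw']⟩

/-- A cylinder ball lies in the prism of the same radius and half-width (walks of the induced graph are walks of `G`). [folklore] -/
theorem cylBall_subset_prism (t : V) (ℓ R : ℕ) : Φ.cylBall t ℓ R ⊆ Φ.toPlanarSkeleton.prism t R ℓ := by
  rintro _ ⟨y, ⟨w, hw⟩, rfl⟩
  obtain ⟨w', hw'⟩ := exists_walk_of_induce w
  exact ⟨⟨w', hw'.le.trans hw⟩, y.2⟩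

end PlanarSkeletonConc

/-- TARGET (OPEN — a `Prop`, never asserted; NOT in print): **the GENERAL DROP NODE in design-(D) form.**  For every connected, locally
finite, countable graph `G` with a `PlanarSkeletonConc` (skeleton + degree bound + outward steps + connected cylinders), every base vertex
`t` and every density `p`: if the infinite cluster of Bernoulli(`p`) bond percolation is a.s. unique, no cylinder percolates at `p`
(`CylSubcritical p`) and `θ_t(p) > 0`, then `θ_t(q) > 0` for some `q < p`.  Intended proof (TOMORROW's critical path, SHEAR-SCOPE §p3 /
V83): the landed concentric Kozma–Nitzan scheme of `thetaDropBoxProdZ2_holds` re-typed over the windows `Win P R` with fibre depth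
`d_G(w₀, ·)`, drift `+50 r` per depth in `gap`/`E₀` and `+2ℓ` per prism scale in `L'`, near-one gluing from `AdditiveGluing` — builds on p205010
(kernel theorem, internal audit signed; external expert review pending).  `CylSubcritical` at the BASE vertices suffices: (κ) + frames +
`ℓ ↦ 2ℓ` give `θ = 0` at every cylinder vertex (the product's `prob_percolatesVia_tube_eq_zero` argument).  Weaker than `SamePDropOfSkeleton`
(more structure assumed).
[cite: KozmaNitzan2024, §1 p. 2 (approach 1), §4 pp. 15–31] [cite: BenjaminiSchramm1996, Conj. 4] -/
@[conjecture] def SamePDropOfSkeletonConc : Prop :=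
  ∀ {V : Type} [DecidableEq V] [Countable V] (G : SimpleGraph V) [G.LocallyFinite] (Φ : PlanarSkeletonConc G),
    G.Connected → ∀ t ∈ Φ.types, ∀ p : unitInterval,
      (∀ᵐ ω ∂bondPercolation G p, numInfiniteClusters ω ≤ 1) → Φ.toPlanarSkeleton.CylSubcritical p → 0 < theta G t p →
        ∃ q : unitInterval, (q : ℝ) < p ∧ 0 < theta G t q

/-- **The general node over bare skeletons implies the (D)-form node** (forget the extra structure); the converse is not claimed. [folklore] -/
theorem samePDropOfSkeletonConc_of_samePDropOfSkeleton (hD : SamePDropOfSkeleton) : SamePDropOfSkeletonConc :=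
  fun G _ Φ hc t ht p hU hC hθ => hD G Φ.toPlanarSkeleton hc t ht p hU hC hθ

/-- **Conditional continuity from the (D)-form node**: uniqueness and cylinders at `p_c` give `θ_t(p_c) = 0` at every base vertex.
[cite: KozmaNitzan2024, §1 p. 2 (approach 1)] -/
theorem continuity_of_skeletonConc_drop (hD : SamePDropOfSkeletonConc) {V : Type} [DecidableEq V] [Countable V]
    (G : SimpleGraph V) [G.LocallyFinite] (Φ : PlanarSkeletonConc G) (hc : G.Connected) (t : V) (ht : t ∈ Φ.types)
    (hU : ∀ᵐ ω ∂bondPercolation G (criticalProbIOf G t), numInfiniteClusters ω ≤ 1)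
    (hC : Φ.toPlanarSkeleton.CylSubcritical (criticalProbIOf G t)) : theta G t (criticalProbIOf G t) = 0 :=
  theta_criticalProbIOf_eq_zero_of_drop_at G t fun hpos => hD G Φ hc t ht _ hU hC hpos

/-- **… on connected, locally finite, quasi-transitive AMENABLE graphs** (uniqueness by the tree's Burton–Keane): the (D)-form node and
cylinders at `p_c` give `θ_t(p_c) = 0`. [cite: BenjaminiSchramm1996, Conj. 4] [cite: LyonsPeres2016, Thm. 7.6] -/
theorem continuity_of_skeletonConc_drop_amenable (hD : SamePDropOfSkeletonConc) {V : Type} [DecidableEq V]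
    (G : SimpleGraph V) [G.LocallyFinite] (Φ : PlanarSkeletonConc G) (hc : G.Connected) (hq : IsQuasiTransitive G)
    (ha : IsGraphAmenable G) (t : V) (ht : t ∈ Φ.types) (hC : Φ.toPlanarSkeleton.CylSubcritical (criticalProbIOf G t)) :
    theta G t (criticalProbIOf G t) = 0 :=
  haveI : Countable V := countable_of_connected_of_locallyFinite G hc t
  continuity_of_skeletonConc_drop hD G Φ hc t ht (BurtonKeane1989_atMostOneInfiniteCluster_holds G hc hq ha _) hC

/-! ## The node WITH the density binder `p < 1` (appended; lead g3 17:53:20Z / 17:54:17Z case (b); refuter p5-g4 17:51:30Z)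

The structure `PlanarSkeletonConc` admits FINITE cylinders (`ℤ² × F`, `F` finite: every field holds, every cylinder `Λ_ℓ × F` is finite, so
`CylSubcritical 1` holds and `θ_t(1) = 1 > 0`): the binder-less node above therefore additionally asserts `p_c(ℤ² × F) < 1` — true, but not
an output of the design-(D) machine (its Step-II counts and `exists_inputs_at_p` need `p < 1`; the product got `p < 1` from `Infinite W`).
The node of record for tomorrow's re-typing and for every instance top is the form below, with `(p : ℝ) < 1` as a hypothesis; at the use
`p = p_c` this is exactly Benjamini–Schramm's `p_c < 1`.  Docstring correction (p5-g4 17:50:36Z nit (a)): `fnSkeleton m` is the RANK-`m`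
skeleton of `N_{m,2}` (node `SamePDropOfSkeletonRank`), not a planar `PlanarSkeletonConc` instance. -/

/-- TARGET (OPEN — a `Prop`, never asserted; NOT in print): **the GENERAL DROP NODE in design-(D) form at densities `p < 1`** —
`SamePDropOfSkeletonConc` with the extra binder `(p : ℝ) < 1`: for every connected, locally finite, countable `G` with a `PlanarSkeletonConc`,
every base vertex `t` and every `p < 1`, a.s. uniqueness at `p`, `CylSubcritical p` and `θ_t(p) > 0` give `θ_t(q) > 0` at some `q < p`.
Normal form at `p = p_c(G, t)`: `p_c < 1 → uniqueness(p_c) → CylSubcritical(p_c) → θ_t(p_c) = 0` (`continuity_of_skeletonConcLt_drop`) —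
the shape of Benjamini–Schramm's Conjecture 4.  THE NODE OF RECORD (lead g3 17:54:17Z): tomorrow's generic re-typing of the landed
concentric scheme (`thetaDropBoxProdZ2_holds`) and every instance top (`…_of_skeletonConcNode`) target THIS form; near-one gluing from
`AdditiveGluing` — builds on p205010 (kernel theorem, internal audit signed; external expert review pending).
[cite: KozmaNitzan2024, §1 p. 2 (approach 1), §4 pp. 15–31] [cite: BenjaminiSchramm1996, Conj. 4] -/
@[conjecture] def SamePDropOfSkeletonConcLt : Prop :=
  ∀ {V : Type} [DecidableEq V] [Countable V] (G : SimpleGraph V) [G.LocallyFinite] (Φ : PlanarSkeletonConc G),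
    G.Connected → ∀ t ∈ Φ.types, ∀ p : unitInterval, (p : ℝ) < 1 →
      (∀ᵐ ω ∂bondPercolation G p, numInfiniteClusters ω ≤ 1) → Φ.toPlanarSkeleton.CylSubcritical p → 0 < theta G t p →
        ∃ q : unitInterval, (q : ℝ) < p ∧ 0 < theta G t q

/-- The binder-less node implies the node of record (drop the hypothesis `p < 1`). [folklore] -/
theorem samePDropOfSkeletonConcLt_of_conc (h : SamePDropOfSkeletonConc) : SamePDropOfSkeletonConcLt :=
  fun G _ Φ hc t ht p _ hU hC hθ => h G Φ hc t ht p hU hC hθ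

/-- The general node over bare skeletons implies the node of record. [folklore] -/
theorem samePDropOfSkeletonConcLt_of_samePDropOfSkeleton (h : SamePDropOfSkeleton) : SamePDropOfSkeletonConcLt :=
  samePDropOfSkeletonConcLt_of_conc (samePDropOfSkeletonConc_of_samePDropOfSkeleton h)

/-- **Conditional continuity from the node of record**: `p_c(G, t) < 1`, uniqueness and cylinders at `p_c` give `θ_t(p_c) = 0` at every base
vertex. [cite: KozmaNitzan2024, §1 p. 2 (approach 1)] [cite: BenjaminiSchramm1996, Conj. 4] -/
theorem continuity_of_skeletonConcLt_drop (hD : SamePDropOfSkeletonConcLt) {V : Type} [DecidableEq V] [Countable V]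
    (G : SimpleGraph V) [G.LocallyFinite] (Φ : PlanarSkeletonConc G) (hc : G.Connected) (t : V) (ht : t ∈ Φ.types)
    (hpc : criticalProb G t < 1) (hU : ∀ᵐ ω ∂bondPercolation G (criticalProbIOf G t), numInfiniteClusters ω ≤ 1)
    (hC : Φ.toPlanarSkeleton.CylSubcritical (criticalProbIOf G t)) : theta G t (criticalProbIOf G t) = 0 :=
  theta_criticalProbIOf_eq_zero_of_drop_at G t fun hpos => hD G Φ hc t ht _ (by exact hpc) hU hC hpos

/-- **… on connected, locally finite, quasi-transitive AMENABLE graphs with `p_c < 1`** (uniqueness by the tree's Burton–Keane): the node of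
record and cylinders at `p_c` give `θ_t(p_c) = 0`. [cite: BenjaminiSchramm1996, Conj. 4] [cite: LyonsPeres2016, Thm. 7.6] -/
theorem continuity_of_skeletonConcLt_drop_amenable (hD : SamePDropOfSkeletonConcLt) {V : Type} [DecidableEq V]
    (G : SimpleGraph V) [G.LocallyFinite] (Φ : PlanarSkeletonConc G) (hc : G.Connected) (hq : IsQuasiTransitive G)
    (ha : IsGraphAmenable G) (t : V) (ht : t ∈ Φ.types) (hpc : criticalProb G t < 1)
    (hC : Φ.toPlanarSkeleton.CylSubcritical (criticalProbIOf G t)) : theta G t (criticalProbIOf G t) = 0 :=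
  haveI : Countable V := countable_of_connected_of_locallyFinite G hc t
  continuity_of_skeletonConcLt_drop hD G Φ hc t ht hpc (BurtonKeane1989_atMostOneInfiniteCluster_holds G hc hq ha _) hC

namespace PlanarSkeletonConc

/-! # APPEND (refuter p5-g4, SHEAR-SCOPE §p5 item 2, lead GO 17:54:40Z): the comparison radius ψ′ = `cylRad` between graph-ball prisms and
induced-cylinder balls, and (below) the NORMAL FORM of the node of record — builds on p205010 (kernel theorem, internal audit signed; external expert review pending) -/

variable {V : Type} {G : SimpleGraph V} [G.LocallyFinite] (Φ : PlanarSkeletonConc G)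

/-! ## The comparison radius ψ′ between graph-ball prisms and induced-cylinder balls (SHEAR-SCOPE §p5 item 2) -/

/-- **The comparison radius `ψ′ = cylRad t ℓ ψ`**: the largest INDUCED-cylinder distance from `t` to a vertex of the graph-ball prism
`graphBall t ψ ∩ cyl t ℓ` (a maximum over a finite set; vertices of the prism not reachable inside the cylinder contribute `0`, which
cannot happen for `ℓ ≥ 1` at a base vertex by (κ)).  In `X □ ℤ²` the two metrics agree and `cylRad t ℓ ψ ≤ ψ`; in `H₃(ℤ)` they differ
quadratically on the centre (`d_G(e, c^n) ≍ 2√n` but the induced distance inside `{|a|,|b| ≤ ℓ}` is `≍ 4n/ℓ`), so this radius is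
what every "graph-ball prism ⊆ fat prism" containment of the product (`fatOrthantFace_subset_frameSeq`, `Ft ⊆ frameSeq ℓ`,
`le_fatRadius`) must go through in the generic re-typing.  [this work] -/
def cylRad (t : V) (ℓ ψ : ℕ) : ℕ :=
  (graphBall_finite G t ψ).toFinset.sup fun w =>
    if h : w ∈ Φ.toPlanarSkeleton.cyl t ℓ then
      (G.induce (Φ.toPlanarSkeleton.cyl t ℓ)).dist ⟨t, Φ.toPlanarSkeleton.mem_cyl_self t ℓ⟩ ⟨w, h⟩
    else 0

/-- The induced-cylinder distance from the centre to a prism vertex is at most `cylRad`. [folklore] -/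
theorem dist_le_cylRad (t : V) (ℓ ψ : ℕ) {w : V} (hw : w ∈ graphBall G t ψ) (hc : w ∈ Φ.toPlanarSkeleton.cyl t ℓ) :
    (G.induce (Φ.toPlanarSkeleton.cyl t ℓ)).dist ⟨t, Φ.toPlanarSkeleton.mem_cyl_self t ℓ⟩ ⟨w, hc⟩ ≤ Φ.cylRad t ℓ ψ := by
  have hmem : w ∈ (graphBall_finite G t ψ).toFinset := (Set.Finite.mem_toFinset _).2 hw
  unfold cylRad
  refine le_trans (le_of_eq ?_) (Finset.le_sup hmem)
  simp only [dif_pos hc]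

/-- **Graph-ball prisms sit inside induced-cylinder balls of radius `ψ′`** (at a base vertex, `ℓ ≥ 1`, by (κ)):
`graphBall t ψ ∩ cyl t ℓ ⊆ cylBall t ℓ (cylRad t ℓ ψ)` — the reverse companion of `cylBall_subset_prism`.  Consumers choose every
fat radius `≥ cylRad t ℓ (kit radius)`; frames transport the containment to every centre of the same type. [this work] -/
theorem graphBall_inter_cyl_subset_cylBall {t : V} (ht : t ∈ Φ.types) {ℓ : ℕ} (hℓ : 1 ≤ ℓ) (ψ : ℕ) :
    graphBall G t ψ ∩ Φ.toPlanarSkeleton.cyl t ℓ ⊆ Φ.cylBall t ℓ (Φ.cylRad t ℓ ψ) := by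
  rintro w ⟨hw, hc⟩
  have hconn := Φ.induce_cyl_connected ht hℓ
  obtain ⟨p, hp⟩ := (hconn.preconnected ⟨t, Φ.toPlanarSkeleton.mem_cyl_self t ℓ⟩ ⟨w, hc⟩).exists_walk_length_eq_dist
  refine ⟨⟨w, hc⟩, ⟨p, ?_⟩, rfl⟩
  rw [hp]
  exact Φ.dist_le_cylRad t ℓ ψ hw hc

/-- `cylRad` is monotone in the prism radius. [folklore] -/
theorem cylRad_mono (t : V) (ℓ : ℕ) {ψ ψ' : ℕ} (h : ψ ≤ ψ') : Φ.cylRad t ℓ ψ ≤ Φ.cylRad t ℓ ψ' := by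
  refine Finset.sup_mono ?_
  intro w hw
  rw [Set.Finite.mem_toFinset] at hw ⊢
  exact graphBall_mono G t h hw

/-- The centre's induced ball of radius `ψ′` also contains the centre's graph-ball prism AND lies in the prism of radius `ψ′`
(two-sided sandwich used when a fat prism must contain a kit cube and sit inside a window). [folklore] -/
theorem prism_sandwich {t : V} (ht : t ∈ Φ.types) {ℓ : ℕ} (hℓ : 1 ≤ ℓ) (ψ : ℕ) :
    graphBall G t ψ ∩ Φ.toPlanarSkeleton.cyl t ℓ ⊆ Φ.cylBall t ℓ (Φ.cylRad t ℓ ψ) ∧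
      Φ.cylBall t ℓ (Φ.cylRad t ℓ ψ) ⊆ Φ.toPlanarSkeleton.prism t (Φ.cylRad t ℓ ψ) ℓ :=
  ⟨Φ.graphBall_inter_cyl_subset_cylBall ht hℓ ψ, Φ.cylBall_subset_prism t ℓ _⟩

end PlanarSkeletonConc

/-! ## Normal form of the node of record (refuter p5-g4; twin of `samePDropOfSkeleton_iff_critical`, p230074): its content sits at `p = p_c` only -/

/-- **The node of record AT CRITICALITY** — Benjamini–Schramm's Conjecture 4 at the base vertices of `PlanarSkeletonConc` graphs, weakened by
the two method hypotheses: `p_c(G,t) < 1`, a.s. uniqueness AT `p_c` and subcritical cylinders AT `p_c` give `θ_t(p_c) = 0`.  A `Prop`, never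
asserted; EQUIVALENT to `SamePDropOfSkeletonConcLt` (next theorem). [cite: BenjaminiSchramm1996, Conj. 4] -/
@[conjecture] def SkeletonConcCriticalContinuity : Prop :=
  ∀ {V : Type} [DecidableEq V] [Countable V] (G : SimpleGraph V) [G.LocallyFinite] (Φ : PlanarSkeletonConc G),
    G.Connected → ∀ t ∈ Φ.types, criticalProb G t < 1 →
      (∀ᵐ ω ∂bondPercolation G (criticalProbIOf G t), numInfiniteClusters ω ≤ 1) →
        Φ.toPlanarSkeleton.CylSubcritical (criticalProbIOf G t) → theta G t (criticalProbIOf G t) = 0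

/-- **NORMAL FORM: `SamePDropOfSkeletonConcLt ↔ SkeletonConcCriticalContinuity`.**  (→) is `continuity_of_skeletonConcLt_drop`; (←): at a
density `p < 1` with `θ_t(p) > 0` one has `p_c ≤ p`; if `p_c < p` the midpoint `q` has `θ_t(q) > 0`, and if `p = p_c` the right-hand side
contradicts `θ_t(p) > 0`.  So the node of record has NO content at supercritical densities, and a counterexample to it is a
`PlanarSkeletonConc` graph with `p_c < 1`, a unique infinite cluster and subcritical cylinders at `p_c`, and `θ_t(p_c) > 0` — a
counterexample to Benjamini–Schramm's Conjecture 4 itself. [cite: BenjaminiSchramm1996, Conj. 4] -/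
theorem samePDropOfSkeletonConcLt_iff_critical : SamePDropOfSkeletonConcLt ↔ SkeletonConcCriticalContinuity := by
  constructor
  · intro hD V _ _ G _ Φ hc t ht hpc hU hC
    exact continuity_of_skeletonConcLt_drop hD G Φ hc t ht hpc hU hC
  · intro hK V _ _ G _ Φ hc t ht p hp1 hU hC hθ
    have hge : criticalProb G t ≤ p :=
      not_lt.1 fun hlt => hθ.ne' (theta_eq_zero_of_lt_criticalProb_holds G t p hlt)
    rcases hge.lt_or_eq with hlt | heq
    · have hpc0 : 0 ≤ criticalProb G t := (criticalProb_mem_Icc G t).1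
      have hp0 : 0 ≤ (p : ℝ) := p.2.1
      have hq1 : (criticalProb G t + p) / 2 ≤ 1 := by linarith [p.2.2]
      refine ⟨⟨(criticalProb G t + p) / 2, by positivity, hq1⟩, ?_, ?_⟩
      · show (criticalProb G t + (p : ℝ)) / 2 < p
        linarith
      · exact theta_pos_of_criticalProb_lt_holds G t _
          (by show criticalProb G t < (criticalProb G t + (p : ℝ)) / 2; linarith)
    · exfalso
      have e : p = criticalProbIOf G t := Subtype.ext heq.symm
      subst e
      exact hθ.ne' (hK G Φ hc t ht (by exact hp1) hU hC)

end Summit.CriticalPhenomena.PercolationContinuityZ3.Theorems.Transplant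

end
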